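import Literature.Geometry.Lorentzian.KerrDeSitterFermionicRealAxis
import HarnessLib

/-!
# The radial Teukolsky–Starobinsky constant of Kerr–de Sitter at `|s| = 3/2` (Wu–Yan (A6)) —
# vocabulary only

Definitions with bodies + `simp`/`ring`-level dictionary lemmas. NO named fact, NO coercivity clause,
NO energy identity. Companion of `KerrDeSitterFermionicRealAxis.lean`, which carries the `|s| = 1/2`
vocabulary (`tsLambdaWY`, `tsRadialConstantHalf`, `FermionicTSCoercive`) next to the theorems that
discharge the `|s| = 1/2` clause.

Sources read verbatim (held texts; page/line of the materialised pages):
* [WuYan2004] S.-Q. Wu, M.-L. Yan, *Entropy of a Kerr–de Sitter black hole due to arbitrary spin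
  fields*, Phys. Rev. D 69 (2004) 044019, arXiv:gr-qc/0303076, Appendix A (p. 14 l. 7–35): the
  radial operators `𝒟_n = ∂_r − iχK/Δ_r + nΔ_r'/Δ_r`, `𝒟_n† = ∂_r + iχK/Δ_r + nΔ_r'/Δ_r`, the radial
  equations (A3) (spin `+s`, for `Δ_r^s R_s`, separation constant `λ_s`) and (A4) (spin `−s`), the
  Teukolsky–Starobinsky identities (A5) `Δ_r^s 𝒟₀^{2s} R_{−s} = C_s (Δ_r^s R_s)`,
  `Δ_r^s 𝒟₀^{†2s}(Δ_r^s R_s) = C_s^* R_{−s}` and the constants (A6), third line (p. 14 l. 24–28):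
  `|C_{3/2}|² = (λ_{3/2}² + 4a²/l²)(λ_{3/2} + 1 − a²/l²) − 16χ²ω²(λ_{3/2}α² + α⁴/l² − a²) − 4M²/l²`,
  "where `α² = a² − ma/ω`" (p. 14 l. 34), with `χ = Ξ = 1 + a²Λ/3` and `1/l² = Λ/3`; p. 14 l. 35:
  "the appearance of `|C_{3/2}|²` is the first time, to our knowledge" — printed WITHOUT proof.
* [CasalsTeixeiradacosta2022] M. Casals, R. Teixeira da Costa, Commun. Math. Phys. 394 (2022)
  797–832, arXiv:2105.13329: Theorem 3.10 (v1: 3.11), second bullet (p. 16 l. 85 – p. 17 l. 3), the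
  fermionic real-axis escape clause for `|s| ∈ {1/2, 3/2}`, and its entire printed proof for
  half-integer `s` (p. 17 l. 56): "By the same method [the Teukolsky–Starobinsky identities], one may
  deduce that if `|s| ≤ 2` is half-integer, the energy identity implies that in fact `u ≡ 0` holds
  independently of `ω`."
* [Costa2019] R. Teixeira da Costa, Commun. Math. Phys. 378 (2020) 705–781, arXiv:1910.02854:
  Proposition 2.10 (p. 12 l. 40–57: the radial Teukolsky–Starobinsky constant `ℭ_s` of KERR as the
  eigenvalue of `Δ^s(𝒟₀^∓)^{2s}Δ^s(𝒟₀^±)^{2s}`, "real when `ω` and `λ` are real", explicit form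
  deferred to [Kalnins1989]); Remark 2.12 (p. 12 l. 61–65: for `λ` an ANGULAR eigenvalue,
  "by explicit computation" `ℭ_{3/2} = −𝔅_{3/2} ≥ 0`); Proposition 2.21 (p. 17 l. 30–62: the
  half-integer energy identity, coercive exactly when `ℭ_s ≥ 0`).

## What is here

* `tsRadialConstantThreeHalves M a Λ ω m λ̄` — Wu–Yan's `|C_{3/2}|²` multiplied out
  (`ω²α_W² = aω(aω − m)`, `ω²α_W⁴ = a²(aω − m)²`, so that no `1/ω` appears and `ω = 0` is allowed),
  as a function of Casals–Teixeira da Costa's separation constant `λ̄` through Wu–Yan's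
  `λ_{3/2}(λ̄) = tsLambdaWY a Λ (3/2) ω m λ̄ = λ̄ + (3/2)(1−α) + Ξ²aω(aω − 2m)`
  (`KerrDeSitterFermionicRealAxis.lean`): a cubic in `λ̄` with real coefficients for real `ω`.
* `tsRadialConstantThreeHalves_eq_printed` — equality with the printed form (`α_W² = a² − ma/ω`,
  `ω ≠ 0`).
* Dictionary lemmas: the value at the tree's own separation constant `λ` of
  `IsRadialTeukolskySolution … (3/2) … λ` (`λ_{3/2}(λ̄) = λ`, `tsLambdaWY_lambdaBar`) —
  `tsRadialConstantThreeHalves_lambdaBar`; at spin `−3/2` (`λ_{3/2}(λ̄) = λ + 3(1−α)`,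
  `tsLambdaWY_lambdaBar_neg`) — `tsRadialConstantThreeHalves_lambdaBar_neg`; real data give a real
  value — `tsRadialConstantThreeHalves_ofReal`, `tsRadialConstantThreeHalves_im_eq_zero`.

## What is NOT here, and why

NO coercivity clause at `|s| = 3/2` and NO statement of an energy identity are asserted, as a fact
or otherwise. The half-integer energy identity is PRINTED for Kerr ([Costa2019] Prop. 2.21); for
Kerr–de Sitter the only printed support is the one sentence "by the same method"
([CasalsTeixeiradacosta2022] p. 17 l. 56), and the constant itself is printed without proof
([WuYan2004] (A6)). Whether `ℭ_{3/2}(λ̄) ≥ 0` excludes real-frequency, real-`λ̄` generic-boundary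
solutions at `|s| = 3/2` on Kerr–de Sitter is therefore NOT a citable result; numerical scans of the
region `ℭ_{3/2} ≥ 0` (cell pub-kds, venture `Summits/Ventures/KdS`, pre-registration P-021) are
evidence, not a fact. The `|s| = 1/2` analogue IS a theorem of the tree
(`radial_real_eq_zero_of_fermionicTSCoercive`, 0 facts), and the printed "any real `λ̄`" clause is
false at `|s| = 1/2` where `ℭ_{1/2}(λ̄) < 0` (same venture, P-014). The text of
`tsRadialConstantThreeHalves` / `_eq_printed` is the draft of the cell's literature seat (LIT-1,
2026-08-23), filed unchanged.
-- TODO(general form): the constants `|C_1|²`, `|C_2|²` of (A6) and the identities (A5) themselves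
-- (operators `𝒟_n`, `𝒟_n†`) are not typed; nor is [Costa2019] Prop. 2.10's operator definition.
-/

noncomputable section

open Complex

namespace Literature.Geometry.Lorentzian.KerrDeSitter

/-! ### The constant, as printed (multiplied out) -/

/-- **The radial Teukolsky–Starobinsky constant of Kerr–de Sitter at `|s| = 3/2`** (Wu–Yan (A6),
third line, with `χ = Ξ`, `1/l² = Λ/3` and `ω²α_W² = aω(aω − m)`, `ω²α_W⁴ = a²(aω − m)²` multiplied
out): `ℭ_{3/2}(λ̄) := (λ² + 4a²Λ/3)(λ + 1 − a²Λ/3) − 16Ξ²[λ·aω(aω − m) + (a²Λ/3)(aω − m)² − a²ω²]`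
`− 4M²Λ/3`, `λ = λ_{3/2}(λ̄) = λ̄ + 3(1−α)/2 + Ξ²aω(aω − 2m)` (Wu–Yan's separation constant of
(A3), `tsLambdaWY`). A cubic in `λ̄`, real for real `ω`, `λ̄`; NOT a priori non-negative. Printed
without proof ("the appearance of `|C_{3/2}|²` is the first time, to our knowledge"); for `Λ = 0` it
is the Kerr constant `ℭ_{3/2}` of [Costa2019] Prop. 2.10 (not printed explicitly there). NO sign
statement and NO energy identity is asserted about it anywhere in the tree.
[cite: WuYan2004, Appendix A, (A6)] -/
def tsRadialConstantThreeHalves (M a Λ : ℝ) (ω : ℂ) (m : ℝ) (lamBar : ℂ) : ℂ :=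
  (tsLambdaWY a Λ (3 / 2) ω m lamBar ^ 2 + ((4 * a ^ 2 * (Λ / 3) : ℝ) : ℂ)) *
      (tsLambdaWY a Λ (3 / 2) ω m lamBar + 1 - (alpha a Λ : ℂ)) -
    16 * (xi a Λ : ℂ) ^ 2 *
      (tsLambdaWY a Λ (3 / 2) ω m lamBar * ((a : ℂ) * ω) * ((a : ℂ) * ω - (m : ℂ)) +
        (alpha a Λ : ℂ) * ((a : ℂ) * ω - (m : ℂ)) ^ 2 - (a : ℂ) ^ 2 * ω ^ 2) -
    ((4 * M ^ 2 * (Λ / 3) : ℝ) : ℂ)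

/-- Wu–Yan's printed form of `|C_{3/2}|²` (with `α_W² = a² − ma/ω`, `ω ≠ 0`, `χ = Ξ`, `1/l² = Λ/3`)
equals the multiplied-out `tsRadialConstantThreeHalves`. [cite: WuYan2004, Appendix A, (A6)] -/
theorem tsRadialConstantThreeHalves_eq_printed (M a Λ : ℝ) {ω : ℂ} (hω : ω ≠ 0) (m : ℝ)
    (lamBar : ℂ) :
    tsRadialConstantThreeHalves M a Λ ω m lamBar =
      (tsLambdaWY a Λ (3 / 2) ω m lamBar ^ 2 + 4 * (a : ℂ) ^ 2 * (Λ / 3 : ℝ)) *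
          (tsLambdaWY a Λ (3 / 2) ω m lamBar + 1 - (a : ℂ) ^ 2 * (Λ / 3 : ℝ)) -
        16 * (xi a Λ : ℂ) ^ 2 * ω ^ 2 *
          (tsLambdaWY a Λ (3 / 2) ω m lamBar * ((a : ℂ) ^ 2 - (m : ℂ) * (a : ℂ) / ω) +
            ((a : ℂ) ^ 2 - (m : ℂ) * (a : ℂ) / ω) ^ 2 * (Λ / 3 : ℝ) - (a : ℂ) ^ 2) -
        4 * (M : ℂ) ^ 2 * (Λ / 3 : ℝ) := by
  simp only [tsRadialConstantThreeHalves, alpha]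
  push_cast
  field_simp

/-! ### Dictionary: the value at the tree's separation constants, and reality -/

/-- **At spin `+3/2` of the tree.** For the separation constant `λ` of
`IsRadialTeukolskySolution M a Λ (3/2) ω m λ` one has `λ_{3/2}(λ̄) = λ` (`tsLambdaWY_lambdaBar`), so
`ℭ_{3/2}` is the cubic
`(λ² + 4a²Λ/3)(λ + 1 − α) − 16Ξ²[λ·aω(aω − m) + α(aω − m)² − a²ω²] − 4M²Λ/3` in the tree's own `λ`
(`α = Λa²/3`). [cite: WuYan2004, Appendix A, (A3) and (A6)] -/
theorem tsRadialConstantThreeHalves_lambdaBar (M a Λ : ℝ) (ω : ℂ) (m : ℝ) (lam : ℂ) :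
    tsRadialConstantThreeHalves M a Λ ω m (lambdaBar a Λ (3 / 2) ω m lam) =
      (lam ^ 2 + ((4 * a ^ 2 * (Λ / 3) : ℝ) : ℂ)) * (lam + 1 - (alpha a Λ : ℂ)) -
        16 * (xi a Λ : ℂ) ^ 2 *
          (lam * ((a : ℂ) * ω) * ((a : ℂ) * ω - (m : ℂ)) +
            (alpha a Λ : ℂ) * ((a : ℂ) * ω - (m : ℂ)) ^ 2 - (a : ℂ) ^ 2 * ω ^ 2) -
        ((4 * M ^ 2 * (Λ / 3) : ℝ) : ℂ) := by
  simp only [tsRadialConstantThreeHalves, tsLambdaWY_lambdaBar]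

/-- **At spin `−3/2` of the tree** (same `λ̄`, which is spin-flip invariant): for the separation
constant `λ` of `IsRadialTeukolskySolution M a Λ (−3/2) ω m λ` one has `λ_{3/2}(λ̄) = λ + 3(1−α)`
(`tsLambdaWY_lambdaBar_neg`; (A4) is the tree's equation at spin `−s` with `λ = λ_s − 2s(1−α)`).
[cite: WuYan2004, Appendix A, (A4) and (A6)] -/
theorem tsRadialConstantThreeHalves_lambdaBar_neg (M a Λ : ℝ) (ω : ℂ) (m : ℝ) (lam : ℂ) :
    tsRadialConstantThreeHalves M a Λ ω m (lambdaBar a Λ (-(3 / 2)) ω m lam) =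
      ((lam + ((3 * (1 - alpha a Λ) : ℝ) : ℂ)) ^ 2 + ((4 * a ^ 2 * (Λ / 3) : ℝ) : ℂ)) *
          (lam + ((3 * (1 - alpha a Λ) : ℝ) : ℂ) + 1 - (alpha a Λ : ℂ)) -
        16 * (xi a Λ : ℂ) ^ 2 *
          ((lam + ((3 * (1 - alpha a Λ) : ℝ) : ℂ)) * ((a : ℂ) * ω) * ((a : ℂ) * ω - (m : ℂ)) +
            (alpha a Λ : ℂ) * ((a : ℂ) * ω - (m : ℂ)) ^ 2 - (a : ℂ) ^ 2 * ω ^ 2) -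
        ((4 * M ^ 2 * (Λ / 3) : ℝ) : ℂ) := by
  have h : tsLambdaWY a Λ (3 / 2) ω m (lambdaBar a Λ (-(3 / 2)) ω m lam) =
      lam + ((3 * (1 - alpha a Λ) : ℝ) : ℂ) := by
    rw [tsLambdaWY_lambdaBar_neg]
    push_cast
    ring
  simp only [tsRadialConstantThreeHalves, h]

/-- **Real data give a real constant**: for real `ω` and real `λ̄`, `ℭ_{3/2}(λ̄)` is the real cubic
`(λ² + 4a²Λ/3)(λ + 1 − α) − 16Ξ²[λ·aω(aω − m) + α(aω − m)² − a²ω²] − 4M²Λ/3`,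
`λ = λ̄ + (3/2)(1−α) − Ξ²(2amω − a²ω²)` ([Costa2019] Prop. 2.10: "if `ω` and `λ` are real, so is
`ℭ_s`"). [cite: WuYan2004, Appendix A, (A6)] -/
theorem tsRadialConstantThreeHalves_ofReal (M a Λ ω m lamBar : ℝ) :
    tsRadialConstantThreeHalves M a Λ (ω : ℂ) m (lamBar : ℂ) =
      (((lamBar + 3 / 2 * (1 - alpha a Λ) - xi a Λ ^ 2 * (2 * a * m * ω - a ^ 2 * ω ^ 2)) ^ 2 +
              4 * a ^ 2 * (Λ / 3)) *
            (lamBar + 3 / 2 * (1 - alpha a Λ) - xi a Λ ^ 2 * (2 * a * m * ω - a ^ 2 * ω ^ 2) +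
              1 - alpha a Λ) -
          16 * xi a Λ ^ 2 *
            ((lamBar + 3 / 2 * (1 - alpha a Λ) - xi a Λ ^ 2 * (2 * a * m * ω - a ^ 2 * ω ^ 2)) *
                (a * ω) * (a * ω - m) +
              alpha a Λ * (a * ω - m) ^ 2 - a ^ 2 * ω ^ 2) -
          4 * M ^ 2 * (Λ / 3) : ℝ) := by
  simp only [tsRadialConstantThreeHalves, tsLambdaWY]
  push_cast
  ring

/-- For real `ω` and real `λ̄` the constant `ℭ_{3/2}(λ̄)` is real ([Costa2019] Prop. 2.10, "if `ω`
and `λ` are real, so is `ℭ_s`", here for the Kerr–de Sitter constant of Wu–Yan).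
[cite: WuYan2004, Appendix A, (A6)] -/
theorem tsRadialConstantThreeHalves_im_eq_zero (M a Λ : ℝ) {ω : ℂ} (hω : ω.im = 0) (m : ℝ)
    {lamBar : ℂ} (hlam : lamBar.im = 0) :
    (tsRadialConstantThreeHalves M a Λ ω m lamBar).im = 0 := by
  have hω' : ω = (ω.re : ℂ) := Complex.ext rfl (by simpa using hω)
  have hlam' : lamBar = (lamBar.re : ℂ) := Complex.ext rfl (by simpa using hlam)
  rw [hω', hlam', tsRadialConstantThreeHalves_ofReal, Complex.ofReal_im]

end Literature.Geometry.Lorentzian.KerrDeSitter
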